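import Literature.NumberTheory.EllipticCurves.ModPImageTransvectionCriterionProofs
import HarnessLib

/-!
# Forced splitting of Kolyvagin primes at an irreducible, non-surjective mod-`p` image (`E/ℚ`)

Topic `NumberTheory/EllipticCurves`; theorems only (nothing is defined, no named fact). Companion of
`ModPImageTransvectionCriterionProofs` (which shows that no `σ ∈ G_{ℚ(μ_p)}` has
`#(E[p]/(σ-1)E[p]) = p`). Here the sharper statement behind it, in the form used by
Kolyvagin-system arguments (Mazur–Rubin 2004, Lemma 3.5.6 (i) and Thm. 3.2.4 (a); Kato 2004
Thm. 13.4 (3); the cell memo `pub/bsd-smallim/koly/KOLY-MEMO.md`, Prop. 2.6):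

**Theorem** (`WeierstrassCurve.galoisRepTorsion_eq_one_of_fixed`). Let `E = W/ℚ` be an elliptic
curve and `p` a prime with `E[p]` irreducible and `ρ̄_{E,p}` NOT surjective. If `σ ∈ Γ_ℚ` has
`χ̄_p(σ) = 1` (e.g. `σ` fixes `μ_p`) and fixes ONE non-zero point of `E[p]`, then `σ` acts
TRIVIALLY on `E[p]`.

In Kolyvagin-prime language: a prime `ℓ ∤ Np` with `ℓ ≡ 1 (mod p)` (Frobenius fixes `μ_p`) and
`p ∣ #Ẽ(𝔽_ℓ)` (Frobenius fixes a point of order `p`, i.e. `P_ℓ(1) ≡ 0`) — the two conditions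
defining Mazur–Rubin's set `𝒫₁` for `T_pE` — necessarily SPLITS COMPLETELY in `ℚ(E[p])`, so that
`E[p]/(Frob_ℓ - 1)E[p] = E[p]` is never cyclic: the Kolyvagin primes usable with a free rank-one
local condition do not exist at such an image (this is why hypothesis (im)/(12.5.2) cannot be
repaired inside a first-order Kolyvagin system; see the memo).

Proof: in a frame `E[p] ≅ 𝔽_p²` the matrix `g` of `σ` has `det g = χ̄_p(σ) = 1` and `g - 1`
singular (a fixed vector); if `g ≠ 1` then `g` is a transvection of order `p` (Cayley–Hamilton),
so `p ∣ #ρ̄(Γ_ℚ)`, and Serre's Prop. 15 (tree: `Serre1972.eq_one_of_det_eq_one_of_det_sub_one_eq_zero`)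
forces the image to be Borel or to contain `SL₂(𝔽_p)` — excluded by irreducibility and
non-surjectivity (`det` is onto).

* `WeierstrassCurve.galoisRepTorsion_eq_one_of_fixed` — hypothesis `χ̄_p(σ) = 1`.
* `WeierstrassCurve.galoisRepTorsion_eq_one_of_fixed_of_forall_smul_eq` — hypothesis "`σ` fixes
  every `p`-th root of unity of `ℚ̄`".

## References

* [Serre1972] J.-P. Serre, Invent. Math. 15 (1972), §2.4 Prop. 15.
* [MazurRubin2004] B. Mazur, K. Rubin, *Kolyvagin systems*, Mem. AMS 799 (2004), §3.5 (H.2),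
  Lemma 3.5.6 (i), Thm. 3.2.4 (a) (cyclicity of `T/(Fr_ℓ - 1)T` on `𝒫`).
* [Kato2004Asterisque] K. Kato, Astérisque 295 (2004), Thm. 13.4 (3).
-/

noncomputable section

open scoped Classical
open Matrix Field

namespace WeierstrassCurve

open Literature.NumberTheory.EllipticCurves Literature.NumberTheory.GaloisRepresentations
  Literature.NumberTheory.GaloisRepresentations.Serre1972

variable (W : WeierstrassCurve ℚ) [W.IsElliptic] (p : ℕ) [Fact p.Prime]

/-- **Forced splitting.** Let `E = W/ℚ` be an elliptic curve and `p` a prime with `E[p]`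
irreducible and `ρ̄_{E,p}` not surjective. If `σ ∈ Γ_ℚ` has trivial mod-`p` cyclotomic character
and fixes a non-zero point of `E[p]`, then `ρ̄_{E,p}(σ) = 1`. (Serre's Prop. 15 read backwards: a
determinant-one element with eigenvalue `1` other than the identity is a transvection of order
`p`, impossible in a proper non-Borel subgroup with full determinant.) In particular every prime
`ℓ ≡ 1 (mod p)` with `p ∣ #Ẽ(𝔽_ℓ)` splits completely in `ℚ(E[p])`, and `E[p]/(Frob_ℓ - 1)E[p]` is
never cyclic — the obstruction to Mazur–Rubin's (H.2) / Kato's Thm. 13.4 (3) at such images.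
[cite: Serre1972, §2.4 Prop. 15] [cite: Kato2004Asterisque, Thm. 13.4 (3)] -/
theorem galoisRepTorsion_eq_one_of_fixed (hirr : W.HasIrreducibleModPGaloisRep p)
    (hns : ¬ W.HasSurjectiveModNGaloisRep p) (σ : absoluteGaloisGroup ℚ)
    (hχ : modPCyclotomicCharacterZMod ℚ p σ = 1) {x : geomTorsion W p} (hx : x ≠ 0)
    (hfix : Multiplicative.toAdd (galoisRepTorsion W p σ) x = x) :
    galoisRepTorsion W p σ = 1 := by
  obtain ⟨e, Φ, he, -, hdetχ, -, -⟩ := exists_frame_galoisRepTorsion_rat W p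
  set G : Subgroup (GL (Fin 2) (ZMod p)) := (galoisRepTorsion W p).range.map Φ.toMonoidHom
    with hG
  set g : GL (Fin 2) (ZMod p) := Φ (galoisRepTorsion W p σ) with hg_def
  have hg : g ∈ G := apply_galoisRepTorsion_mem_map_range W p Φ σ
  have hdet1 : Matrix.GeneralLinearGroup.det g = 1 := by rw [hg_def, hdetχ σ, hχ]
  -- `e x` is a non-zero fixed vector of the matrix `g`, so `g - 1` is singular
  have hex : e x ≠ 0 := fun h0 => hx (e.map_eq_zero_iff.mp h0)
  have hgx : (((g : GL (Fin 2) (ZMod p)) : Matrix (Fin 2) (Fin 2) (ZMod p)) - 1) *ᵥ e x = 0 := by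
    rw [Matrix.sub_mulVec, Matrix.one_mulVec, hg_def, ← he, hfix, sub_self]
  have hsing : (((g : GL (Fin 2) (ZMod p)) : Matrix (Fin 2) (Fin 2) (ZMod p)) - 1).det = 0 :=
    Matrix.exists_mulVec_eq_zero_iff.mp ⟨e x, hex, hgx⟩
  -- the image is proper, has full determinant and no common eigenvector
  have hGtop : G ≠ ⊤ := fun h => hns ((map_range_galoisRepTorsion_eq_top_iff W p Φ).mp h)
  have hdetG : ∀ u : (ZMod p)ˣ, ∃ g ∈ G, Matrix.GeneralLinearGroup.det g = u :=
    exists_mem_map_range_det_eq W p Φ e he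
  have hirrG : ∀ (v : Fin 2 → ZMod p) (hv : v ≠ 0), ¬ G ≤ eigenvectorStabilizer v hv :=
    fun v hv => not_le_eigenvectorStabilizer_of_hasIrreducibleModPGaloisRep W p Φ e he hirr hv
  have hg1 : g = 1 := eq_one_of_det_eq_one_of_det_sub_one_eq_zero G hdetG hGtop hirrG hg hdet1 hsing
  exact Φ.injective (by rw [map_one]; exact hg1)

/-- **Forced splitting, with the literal hypothesis "`σ` fixes `μ_p`".** If `E[p]` is irreducible,
`ρ̄_{E,p}` is not surjective, `σ` fixes every `p`-th root of unity of `ℚ̄` and fixes a non-zero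
point of `E[p]`, then `σ` acts trivially on `E[p]`. [cite: Serre1972, §2.4 Prop. 15] -/
theorem galoisRepTorsion_eq_one_of_fixed_of_forall_smul_eq
    (hirr : W.HasIrreducibleModPGaloisRep p) (hns : ¬ W.HasSurjectiveModNGaloisRep p)
    (σ : absoluteGaloisGroup ℚ) (hσ : ∀ t : AlgebraicClosure ℚ, t ^ p = 1 → σ • t = t)
    {x : geomTorsion W p} (hx : x ≠ 0)
    (hfix : Multiplicative.toAdd (galoisRepTorsion W p σ) x = x) :
    galoisRepTorsion W p σ = 1 :=
  galoisRepTorsion_eq_one_of_fixed W p hirr hns σ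
    (modPCyclotomicCharacterZMod_eq_one_of_forall_smul_eq p σ hσ) hx hfix

end WeierstrassCurve
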